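import Summits.ResolutionOfSingularities.ResolutionOfSingularities.Theorems.PurelyInseparableDim4JointWaitingStepCover
import Summits.ResolutionOfSingularities.ResolutionOfSingularities.Theorems.PurelyInseparableDim4JointWaitingRootHost
import Summits.ResolutionOfSingularities.ResolutionOfSingularities.Theorems.PurelyInseparableDim4JointWaitingMember
import Summits.ResolutionOfSingularities.ResolutionOfSingularities.Theorems.PurelyInseparableDim4JointWaitingSurvivors
import HarnessLib

/-!
# Purely inseparable four-folds: the joint forest from a root host with WAITING MEMBERS, OTHER MEMBERS and ISOLATED POINTS —
# v3-lite-FULL = part 21 ∪ part 38 (brick S3 (c) «joint point∘coordinate chains», part 42b; cell `res-dim4-pi`)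

[OURS · counted 0] (D-0157 DOOR 2; WORD #66 (4)(c), #74 (g), #99 (d); host item stmt-ResolutionOfSingularities-16155, helper). Nothing
here proves resolution of singularities in dimension ≥ 4 / characteristic `p` — NOT here, not anywhere in this programme.
**`exists_isMarkedResolution_joint_forest_root_waiting_members`** — part 38 (host `(b₀, S₀)`, root node `Pl₀`/`Wt`/`L₀`, three-way
cover, v2 below) PLUS part 21's other root members `mem` (separated pairwise, from the host on `S₀ ∩ S₁`, from every waiting member on
`T ∩ S₁`) PLUS finitely many ISOLATED root points with point walks ⇒ a marked resolution of `(𝔸⁵_K, (z^p + F)·𝒪, [], p)`. The other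
members and isolated points SURVIVE the blow-up of the host (part 42a); first-stage members = children ∪ waiting kids ∪ survivors,
point members = leaves ∪ surviving isolated points; then part 20's node theorem. HONEST SCOPE: waiting members at the root host only;
v2 below; `Acc` a hypothesis. AI-produced formalisation, weaker than expert review.
bears_on: LADDER-RESOLUTION:D157-DOOR2 (res-dim4-pi · S3 (c) joint v3-lite-full · root).
-/

set_option linter.dupNamespace false -- D-0017: single-problem summit path `Summit.<S>.<S>.…` by design

noncomputable section

open MvPolynomial Finset CategoryTheory AlgebraicGeometry Opposite TopologicalSpace
open AlgebraicGeometry.Scheme.IdealSheafData (ofIdealTop vanishingIdeal)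

namespace Summit.ResolutionOfSingularities.ResolutionOfSingularities.Theorems.PIDim4

open Literature.AlgebraicGeometry.Resolution
open Literature.AlgebraicGeometry.Resolution.Hauser2010
open Literature.AlgebraicGeometry.Resolution.AffinePointBlowup (P A γ coord Wtop ξ)

namespace Equimultiple

section RootWaiting

variable {K : Type} [Field K] {p : ℕ} [hp : Fact p.Prime] [CharP K p]

/-- **THE JOINT FOREST FROM A ROOT HOST WITH WAITING MEMBERS, OTHER MEMBERS AND ISOLATED POINTS.** See the module docstring.
[cite: BierstoneGrigorievMilmanWlodarczyk2011, Def. 3.1.3; §4 Step 2b] [cite: Hauser2010, §§F–G]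
[cite: HauserPerlega2019PRIMS, §2 (permissible centres P = (z, x_i : i ∈ Γ))]
[cite: Hironaka1964, Main Theorem I (the characteristic-zero statement whose analogue is asked)] -/
theorem exists_isMarkedResolution_joint_forest_root_waiting_members [IsAlgClosed K] [DecidableEq K] (F : MvPolynomial (Fin 4) K)
    (hF : F ≠ 0) (hclean : Literature.Barriers.ResolutionOfSingularities.HauserPerlega.IsClean p F)
    (plan : State K → Finset (Fin 4) → Finset (Fin 4 × (Fin 4 → K) × Finset (Fin 4)))
    (leaves : State K → Finset (Fin 4) → Finset (Fin 4 × (Fin 4 → K)))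
    (b₀ : Fin 4 → K) (S₀ : Finset (Fin 4)) (s₀ : State K)
    (hs₀ : s₀ = ⟨deletePthPowers p (PointBlowup.translate b₀ F), 0, ∅⟩) (hS₀ : IsPermissibleCentre p S₀ s₀.F)
    (Pl₀ : Finset (Fin 4 × (Fin 4 → K) × Finset (Fin 4))) (Wt : Finset (Fin 4 × (Fin 4 → K) × Finset (Fin 4)))
    (L₀ : Finset (Fin 4 × (Fin 4 → K)))
    (hP1₀ : ∀ e ∈ Pl₀, e.1 ∈ S₀ ∧ e.2.1 e.1 = 0 ∧ S₀ ⊆ e.2.2 ∧ CentreBlowup.IsEquimultiplePoint p S₀ e.1 e.2.1 s₀ ∧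
      IsPermissibleCentre p e.2.2 (CentreBlowup.step p S₀ e.1 e.2.1 s₀).F)
    (hP2₀ : ∀ e ∈ Pl₀, ∀ e' ∈ Pl₀, e ≠ e' →
      (e.1 = e'.1 ∧ ∃ i ∈ e.2.2, i ∈ e'.2.2 ∧ e.2.1 i ≠ e'.2.1 i) ∨
      (e.1 ≠ e'.1 ∧ ((e'.2.1 e.1 = 0 ∧ e.1 ∈ e'.2.2) ∨ (e.2.1 e'.1 = 0 ∧ e'.1 ∈ e.2.2))))
    (hW1 : ∀ wt ∈ Wt, wt.1 ∈ S₀ ∧ (∀ i ∈ S₀, wt.2.1 i = 0) ∧ S₀.erase wt.1 ⊆ wt.2.2 ∧ wt.1 ∉ wt.2.2 ∧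
      IsPermissibleCentre p wt.2.2 (PointBlowup.translate wt.2.1 s₀.F))
    (hW2 : ∀ wt ∈ Wt, ∀ wt' ∈ Wt, wt ≠ wt' → wt.1 = wt'.1 → ∃ i ∈ wt.2.2, i ∈ wt'.2.2 ∧ wt.2.1 i ≠ wt'.2.1 i)
    (hPW : ∀ e ∈ Pl₀, ∀ wt ∈ Wt, e.1 = wt.1 → ∃ i ∈ e.2.2, i ∈ wt.2.2 ∧ e.2.1 i ≠ wt.2.1 i)
    (hP3₀ : ∀ l ∈ L₀, CentreBlowup.IsEquimultiplePoint p S₀ l.1 l.2 s₀ →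
      Acc (fun s' s : State K => Edge p Finset.univ s s') (CentreBlowup.step p S₀ l.1 l.2 s₀) ∧
      ∀ s' : State K, Relation.ReflTransGen (fun a e : State K => Edge p Finset.univ a e)
          (CentreBlowup.step p S₀ l.1 l.2 s₀) s' →
        {jb : Fin 4 × (Fin 4 → K) | jb.2 jb.1 = 0 ∧ CentreBlowup.IsEquimultiplePoint p Finset.univ jb.1 jb.2 s'}.Finite)
    (hcover₀ : ∀ (j' : Fin 4) (b' : Fin 4 → K), j' ∈ S₀ → b' j' = 0 → (∀ k ∈ S₀, k < j' → b' k = 0) →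
      CentreBlowup.IsEquimultiplePoint p S₀ j' b' s₀ →
      (∃ e ∈ Pl₀, e.1 = j' ∧ ∀ i ∈ e.2.2, b' i = e.2.1 i) ∨ (∃ wt ∈ Wt, wt.1 = j' ∧ ∀ i ∈ wt.2.2, b' i = wt.2.1 i) ∨
        (j', b') ∈ L₀)
    (hplan : ∀ q : State K × Finset (Fin 4),
      ((∃ e ∈ Pl₀, Relation.ReflTransGen (fun q q' : State K × Finset (Fin 4) =>
          ∃ e ∈ plan q.1 q.2, q' = (CentreBlowup.step p q.2 e.1 e.2.1 q.1, e.2.2))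
          (CentreBlowup.step p S₀ e.1 e.2.1 s₀, e.2.2) q) ∨
        ∃ wt ∈ Wt, Relation.ReflTransGen (fun q q' : State K × Finset (Fin 4) =>
          ∃ e ∈ plan q.1 q.2, q' = (CentreBlowup.step p q.2 e.1 e.2.1 q.1, e.2.2))
          (CentreBlowup.step p S₀ wt.1 wt.2.1 s₀, wt.2.2) q) →
      (∀ e ∈ plan q.1 q.2, e.1 ∈ q.2 ∧ e.2.1 e.1 = 0 ∧ q.2 ⊆ e.2.2 ∧
          CentreBlowup.IsEquimultiplePoint p q.2 e.1 e.2.1 q.1 ∧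
          IsPermissibleCentre p e.2.2 (CentreBlowup.step p q.2 e.1 e.2.1 q.1).F) ∧
      (∀ e ∈ plan q.1 q.2, ∀ e' ∈ plan q.1 q.2, e ≠ e' →
          (e.1 = e'.1 ∧ ∃ i ∈ e.2.2, i ∈ e'.2.2 ∧ e.2.1 i ≠ e'.2.1 i) ∨
          (e.1 ≠ e'.1 ∧ ((e'.2.1 e.1 = 0 ∧ e.1 ∈ e'.2.2) ∨ (e.2.1 e'.1 = 0 ∧ e'.1 ∈ e.2.2)))) ∧
      (∀ l ∈ leaves q.1 q.2, CentreBlowup.IsEquimultiplePoint p q.2 l.1 l.2 q.1 →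
          Acc (fun s' s : State K => Edge p Finset.univ s s') (CentreBlowup.step p q.2 l.1 l.2 q.1) ∧
          ∀ s' : State K, Relation.ReflTransGen (fun a e : State K => Edge p Finset.univ a e)
              (CentreBlowup.step p q.2 l.1 l.2 q.1) s' →
            {jb : Fin 4 × (Fin 4 → K) | jb.2 jb.1 = 0 ∧
              CentreBlowup.IsEquimultiplePoint p Finset.univ jb.1 jb.2 s'}.Finite) ∧
      (∀ (j' : Fin 4) (b' : Fin 4 → K), j' ∈ q.2 → b' j' = 0 → (∀ k ∈ q.2, k < j' → b' k = 0) →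
          CentreBlowup.IsEquimultiplePoint p q.2 j' b' q.1 →
          (∃ e ∈ plan q.1 q.2, e.1 = j' ∧ ∀ i ∈ e.2.2, b' i = e.2.1 i) ∨ (j', b') ∈ leaves q.1 q.2))
    (hacc : ∀ e ∈ Pl₀, Acc (fun q' q : State K × Finset (Fin 4) =>
        ∃ e ∈ plan q.1 q.2, q' = (CentreBlowup.step p q.2 e.1 e.2.1 q.1, e.2.2))
      (CentreBlowup.step p S₀ e.1 e.2.1 s₀, e.2.2))
    (hWacc : ∀ wt ∈ Wt, Acc (fun q' q : State K × Finset (Fin 4) =>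
        ∃ e ∈ plan q.1 q.2, q' = (CentreBlowup.step p q.2 e.1 e.2.1 q.1, e.2.2))
      (CentreBlowup.step p S₀ wt.1 wt.2.1 s₀, wt.2.2))
    (mem : Finset ((Fin 4 → K) × Finset (Fin 4)))
    (hmem : ∀ bS ∈ mem, IsPermissibleCentre p bS.2 (deletePthPowers p (PointBlowup.translate bS.1 F)) ∧
      (∀ q : State K × Finset (Fin 4),
        Relation.ReflTransGen (fun q q' : State K × Finset (Fin 4) =>
          ∃ e ∈ plan q.1 q.2, q' = (CentreBlowup.step p q.2 e.1 e.2.1 q.1, e.2.2))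
          ((⟨deletePthPowers p (PointBlowup.translate bS.1 F), 0, ∅⟩ : State K), bS.2) q →
        (∀ e ∈ plan q.1 q.2, e.1 ∈ q.2 ∧ e.2.1 e.1 = 0 ∧ q.2 ⊆ e.2.2 ∧
            CentreBlowup.IsEquimultiplePoint p q.2 e.1 e.2.1 q.1 ∧
            IsPermissibleCentre p e.2.2 (CentreBlowup.step p q.2 e.1 e.2.1 q.1).F) ∧
        (∀ e ∈ plan q.1 q.2, ∀ e' ∈ plan q.1 q.2, e ≠ e' →
            (e.1 = e'.1 ∧ ∃ i ∈ e.2.2, i ∈ e'.2.2 ∧ e.2.1 i ≠ e'.2.1 i) ∨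
            (e.1 ≠ e'.1 ∧ ((e'.2.1 e.1 = 0 ∧ e.1 ∈ e'.2.2) ∨ (e.2.1 e'.1 = 0 ∧ e'.1 ∈ e.2.2)))) ∧
        (∀ l ∈ leaves q.1 q.2, CentreBlowup.IsEquimultiplePoint p q.2 l.1 l.2 q.1 →
            Acc (fun s' s : State K => Edge p Finset.univ s s') (CentreBlowup.step p q.2 l.1 l.2 q.1) ∧
            ∀ s' : State K, Relation.ReflTransGen (fun a e : State K => Edge p Finset.univ a e)
                (CentreBlowup.step p q.2 l.1 l.2 q.1) s' →
              {jb : Fin 4 × (Fin 4 → K) | jb.2 jb.1 = 0 ∧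
                CentreBlowup.IsEquimultiplePoint p Finset.univ jb.1 jb.2 s'}.Finite) ∧
        (∀ (j' : Fin 4) (b' : Fin 4 → K), j' ∈ q.2 → b' j' = 0 → (∀ k ∈ q.2, k < j' → b' k = 0) →
            CentreBlowup.IsEquimultiplePoint p q.2 j' b' q.1 →
            (∃ e ∈ plan q.1 q.2, e.1 = j' ∧ ∀ i ∈ e.2.2, b' i = e.2.1 i) ∨ (j', b') ∈ leaves q.1 q.2)) ∧
      Acc (fun q' q : State K × Finset (Fin 4) =>
          ∃ e ∈ plan q.1 q.2, q' = (CentreBlowup.step p q.2 e.1 e.2.1 q.1, e.2.2))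
        ((⟨deletePthPowers p (PointBlowup.translate bS.1 F), 0, ∅⟩ : State K), bS.2))
    (hsep : ∀ bS ∈ mem, ∀ bS' ∈ mem, bS ≠ bS' → ∃ i ∈ bS.2, i ∈ bS'.2 ∧ bS.1 i ≠ bS'.1 i)
    (hsep₀ : ∀ bS ∈ mem, ∃ i ∈ bS.2, i ∈ S₀ ∧ bS.1 i ≠ b₀ i)
    (hWsep : ∀ bS ∈ mem, ∀ wt ∈ Wt, ∃ i ∈ bS.2, i ∈ wt.2.2 ∧ bS.1 i ≠ b₀ i + wt.2.1 i)
    (hroots : {b' : Fin 4 → K | (∀ d : Fin 4 →₀ ℕ, d ≠ 0 → d.degree < p →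
        coeff d (PointBlowup.translate b' F) = 0) ∧ (¬ ∀ i ∈ S₀, b' i = b₀ i) ∧
        (∀ wt ∈ Wt, ¬ ∀ i ∈ wt.2.2, b' i = b₀ i + wt.2.1 i) ∧ ∀ bS ∈ mem, ¬ ∀ i ∈ bS.2, b' i = bS.1 i}.Finite)
    (hwalk₀ : ∀ b' : Fin 4 → K, (∀ d : Fin 4 →₀ ℕ, d ≠ 0 → d.degree < p → coeff d (PointBlowup.translate b' F) = 0) →
      (¬ ∀ i ∈ S₀, b' i = b₀ i) → (∀ wt ∈ Wt, ¬ ∀ i ∈ wt.2.2, b' i = b₀ i + wt.2.1 i) →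
      (∀ bS ∈ mem, ¬ ∀ i ∈ bS.2, b' i = bS.1 i) →
      Acc (fun s' s : State K => Edge p Finset.univ s s')
          (⟨deletePthPowers p (PointBlowup.translate b' F), 0, ∅⟩ : State K) ∧
        ∀ s' : State K, Relation.ReflTransGen (fun a e : State K => Edge p Finset.univ a e)
            (⟨deletePthPowers p (PointBlowup.translate b' F), 0, ∅⟩ : State K) s' →
          {jb : Fin 4 × (Fin 4 → K) | jb.2 jb.1 = 0 ∧
            CentreBlowup.IsEquimultiplePoint p Finset.univ jb.1 jb.2 s'}.Finite) :
    ∃ (X' : Scheme.{0}) (ρ : X' ⟶ P 4 K) (M' : MarkedIdeal X'),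
      IsMarkedResolution (⟨hypSheaf p F, [], p⟩ : MarkedIdeal (P 4 K)) ρ M' := by
  classical
  haveI : PerfectRing K p := PerfectRing.ofSurjective K p fun x => IsAlgClosed.exists_pow_nat_eq x hp.out.pos
  set M₀ : MarkedIdeal (P 4 K) := ⟨hypSheaf p F, [], p⟩ with hM₀
  have hE₀ : HasSNC M₀.boundary :=
    hasSNC_nil_of_isRegular (Literature.AlgebraicGeometry.Hironaka2017.Lib.AffinePointBlowupLSB.isRegular_Z 4 K)
  have hF₀ : s₀.F ≠ 0 := by rw [hs₀]; exact deletePthPowers_translate_ne_zero hF hclean b₀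
  have hclean₀ : Literature.Barriers.ResolutionOfSingularities.HauserPerlega.IsClean p s₀.F := by
    rw [hs₀]; exact isClean_deletePthPowers _
  have hS₀' : IsPermissibleCentre p S₀ (deletePthPowers p (PointBlowup.translate b₀ F)) := by rw [hs₀] at hS₀; exact hS₀
  obtain ⟨φ, _, c₀, hsurj, hMφ, hcoord', hcoe₀, hreg₀, hsnc₀, hZ₀, hin₀, hon₀⟩ := root_host_package (p := p) F b₀ hS₀'
  have hM : M₀.ideal.comap φ = (hypSheaf p s₀.F).comap (𝟙 (P 4 K)) := by
    rw [Scheme.IdealSheafData.comap_id, hs₀]; exact hMφ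
  set Λ : Set (Fin (4 + 1)) := insert 0 (Fin.succ '' (S₀ : Set (Fin 4))) with hΛ
  have hid : ∀ T : Set (P 4 K), (𝟙 (P 4 K) : P 4 K ⟶ P 4 K) ⁻¹' T = T := fun T => rfl
  have himg : φ '' ((𝟙 (P 4 K) : P 4 K ⟶ P 4 K) ⁻¹' (AffineCoordBlowup.CΛ 4 K Λ : Set (P 4 K))) = (c₀ : Set (P 4 K)) := by
    rw [hid, hcoe₀]
  have hT₀ : IsClosed (φ '' ((𝟙 (P 4 K) : P 4 K ⟶ P 4 K) ⁻¹' (AffineCoordBlowup.CΛ 4 K Λ : Set (P 4 K)))) :=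
    himg ▸ c₀.isClosed
  have hsee₀ : (AffineCoordBlowup.CΛ 4 K Λ : Set (P 4 K)) ⊆ Set.range (𝟙 (P 4 K) : P 4 K ⟶ P 4 K) := fun y _ => ⟨y, rfl⟩
  have hψ : ∀ x : P 4 K, x ∈ Set.range (𝟙 (P 4 K) : P 4 K ⟶ P 4 K) := fun x => ⟨x, rfl⟩
  have hφc : IsClosed (Set.range φ) := by rw [hsurj.range_eq]; exact isClosed_univ
  have hZφ : (vanishingIdeal c₀).comap φ = (AffineCoordBlowup.𝓘Λ 4 K Λ).comap (𝟙 (P 4 K)) := by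
    rw [Scheme.IdealSheafData.comap_id]; exact hZ₀
  set Ce : (P 4 K).IdealSheafData := vanishingIdeal c₀ with hCe
  have hπ : IsBlowup (blowup.π Ce) Ce := blowup.isBlowup Ce
  have hCsupp : ∀ z : P 4 K, z ∉ (Ce.support : Set (P 4 K)) ↔ z ∉ (c₀ : Set (P 4 K)) := fun z => by
    rw [hCe, Scheme.IdealSheafData.coe_support_vanishingIdeal]
  have hc₀supp : (c₀ : Set (P 4 K)) ⊆ M₀.support :=
    coe_member_subset_support φ (𝟙 _) M₀ rfl _ hM hS₀.2 c₀ hZφ (by rw [hsurj.range_eq]; exact Set.subset_univ _)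
  have h₁ : IsMultipleBlowup M₀ (blowup.π Ce ≫ 𝟙 _) (M₀.transform (blowup.π Ce) Ce) :=
    IsMultipleBlowup.blowup (IsMultipleBlowup.refl M₀) Ce (blowup.π Ce) hπ hreg₀
      (by rw [hCe, Scheme.IdealSheafData.coe_support_vanishingIdeal]; exact hc₀supp) hsnc₀
  haveI : IsLocallyNoetherian (blowup Ce) := h₁.isLocallyNoetherian
  set M₁ := M₀.transform (blowup.π Ce) Ce with hM₁
  have hM₁I : M₁.ideal = controlledTransform (blowup.π Ce) Ce M₀.ideal M₀.mult := rfl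
  set B := blowup.π (AffineCoordBlowup.𝓘Λ 4 K Λ) with hBdef
  have hB : IsBlowup B (AffineCoordBlowup.𝓘Λ 4 K Λ) := blowup.isBlowup _
  obtain ⟨ε, hsq, hC', hKEY⟩ := ChartDictionary.exists_iso_restrict_blowup_zigzag φ (𝟙 _) _ Ce hZφ hπ hB
  have hK := hKEY M₀.ideal (hypSheaf p s₀.F) p hM
  have hW1' : ∀ wt ∈ Wt, wt.1 ∈ S₀ ∧ (∀ i ∈ S₀, wt.2.1 i = 0) ∧ S₀.erase wt.1 ⊆ wt.2.2 ∧ wt.1 ∉ wt.2.2 ∧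
      IsPermissibleCentre p wt.2.2 (CentreBlowup.step p S₀ wt.1 wt.2.1 s₀).F := fun wt hwt =>
    ⟨(hW1 wt hwt).1, (hW1 wt hwt).2.1, (hW1 wt hwt).2.2.1, (hW1 wt hwt).2.2.2.1,
      isPermissibleCentre_step_of_not_mem (hW1 wt hwt).1 (hW1 wt hwt).2.2.2.1 (hW1 wt hwt).2.1 s₀ (hW1 wt hwt).2.2.2.2⟩
  obtain ⟨kid, wkid, hkid, hwkid, hkdisj, hkw, hww, hkcover, hwcover, hkfin⟩ :=
    joint_forest_step_waiting_cover φ (𝟙 _) ε Ce hπ hB hsq hC' M₀ rfl rfl s₀ hK hS₀ hsee₀ hT₀ hψ hφc hsnc₀ Pl₀ hP1₀ hP2₀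
      Wt hW1' hW2 hPW L₀ hcover₀
  obtain ⟨survF, cstS, ctrS, surv, stS, hsdata, hsdisj, hsoff, hsurv, hsurvoff, hscover⟩ :=
    root_survivors_package (p := p) F hF hclean plan leaves mem hmem hsep b₀ S₀ Wt hsep₀ hWsep c₀ Ce rfl hin₀ hon₀ hsnc₀ M₁ rfl hroots hwalk₀
  have hkid_over : ∀ e ∈ Pl₀, ∀ w ∈ (kid e : Set (blowup Ce)), blowup.π Ce w ∈ (c₀ : Set (P 4 K)) := fun e he w hw => by
    have h := (hkid e he).2.2.2.1 hw; rwa [Set.mem_preimage, himg] at h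
  have hwkid_coords : ∀ wt ∈ Wt, ∀ w ∈ (wkid wt : Set (blowup Ce)), ∀ i ∈ wt.2.2,
      (X i.succ - C (b₀ i + wt.2.1 i) : A 4 K) ∈ (blowup.π Ce w).asIdeal := fun wt hwt w hw i hi => by
    obtain ⟨y, hy, hyw⟩ := (hwkid wt hwt).2.2.2.1 w hw
    rw [← hyw, hcoord']
    exact hy i hi
  have hkid_inj : ∀ e ∈ Pl₀, ∀ e' ∈ Pl₀, kid e = kid e' → e = e' := fun e he e' he' hee => by
    by_contra hne
    obtain ⟨w, hw⟩ := (hkid e he).2.2.2.2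
    exact Set.disjoint_left.mp (hkdisj e he e' he' hne) hw (by rw [← hee]; exact hw)
  have hwkid_inj : ∀ wt ∈ Wt, ∀ wt' ∈ Wt, wkid wt = wkid wt' → wt = wt' := fun wt hwt wt' hwt' hee => by
    by_contra hne
    obtain ⟨w, hw⟩ := (hwkid wt hwt).2.2.2.2
    exact Set.disjoint_left.mp (hww wt hwt wt' hwt' hne) hw (by rw [← hee]; exact hw)
  have hkid_ne_wkid : ∀ e ∈ Pl₀, ∀ wt ∈ Wt, kid e ≠ wkid wt := fun e he wt hwt hee => by
    obtain ⟨w, hw⟩ := (hkid e he).2.2.2.2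
    exact Set.disjoint_left.mp (hkw e he wt hwt) hw (by rw [← hee]; exact hw)
  have hkid_ne_surv : ∀ e ∈ Pl₀, ∀ d ∈ survF, kid e ≠ d := fun e he d hd hee => by
    obtain ⟨w, hw⟩ := (hkid e he).2.2.2.2
    exact (hsoff d hd w (hee ▸ hw)).1 (hkid_over e he w hw)
  have hwkid_ne_surv : ∀ wt ∈ Wt, ∀ d ∈ survF, wkid wt ≠ d := fun wt hwt d hd hee => by
    obtain ⟨w, hw⟩ := (hwkid wt hwt).2.2.2.2
    exact (hsoff d hd w (hee ▸ hw)).2 wt hwt (hwkid_coords wt hwt w hw)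
  rw [himg] at hkfin
  set ov : Finset (blowup Ce) := hkfin.toFinset with hov_def
  have hmem_over : ∀ w, w ∈ ov ↔ IsClosed ({w} : Set (blowup Ce)) ∧ blowup.π Ce w ∈ (c₀ : Set (P 4 K)) ∧
      (p : ℕ∞) ≤ idealOrder M₁.ideal w ∧ (∀ e ∈ Pl₀, w ∉ (kid e : Set (blowup Ce))) ∧
      ∀ wt ∈ Wt, w ∉ (wkid wt : Set (blowup Ce)) := fun w => by
    rw [hov_def, Set.Finite.mem_toFinset, Set.mem_setOf_eq]
  have hleaf : ∀ w : blowup Ce, IsClosed ({w} : Set (blowup Ce)) → blowup.π Ce w ∈ (c₀ : Set (P 4 K)) →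
      (p : ℕ∞) ≤ idealOrder M₁.ideal w → (∀ e ∈ Pl₀, w ∉ (kid e : Set (blowup Ce))) →
      (∀ wt ∈ Wt, w ∉ (wkid wt : Set (blowup Ce))) →
      ∃ l ∈ L₀, l.1 ∈ S₀ ∧ l.2 l.1 = 0 ∧ CentreBlowup.IsEquimultiplePoint p S₀ l.1 l.2 s₀ ∧
        ∃ (Y' : Scheme.{0}) (φ' : Y' ⟶ blowup Ce) (ψ' : Y' ⟶ P 4 K) (_ : IsOpenImmersion φ') (_ : IsOpenImmersion ψ')
          (y' : Y'), φ' y' = w ∧ ψ' y' = ξ 4 K ∧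
          M₁.ideal.comap φ' = (hypSheaf p (CentreBlowup.step p S₀ l.1 l.2 s₀).F).comap ψ' := by
    intro w hw hwc hord hout houtw
    rw [← himg] at hwc
    rcases hkcover w hw hwc hord with ⟨e, he, hwe⟩ | ⟨wt, hwt, hwe⟩ | h
    · exact absurd hwe (hout e he)
    · exact absurd hwe (houtw wt hwt)
    · exact h
  have hdisj_os : Disjoint ov surv := Finset.disjoint_left.mpr fun ⦃w⦄ hw hw' =>
    (hsurvoff w hw').1 ((hmem_over w).mp hw).2.1
  set pts' : Finset (blowup Ce) := ov.disjUnion surv hdisj_os with hpts'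
  have hmem' : ∀ w, w ∈ pts' ↔ w ∈ ov ∨ w ∈ surv := fun w => Finset.mem_disjUnion
  set st' : blowup Ce → State K := fun w =>
    if hc : IsClosed ({w} : Set (blowup Ce)) ∧ blowup.π Ce w ∈ (c₀ : Set (P 4 K)) ∧
        (p : ℕ∞) ≤ idealOrder M₁.ideal w ∧ (∀ e ∈ Pl₀, w ∉ (kid e : Set (blowup Ce))) ∧
        ∀ wt ∈ Wt, w ∉ (wkid wt : Set (blowup Ce)) then
      CentreBlowup.step p S₀ (hleaf w hc.1 hc.2.1 hc.2.2.1 hc.2.2.2.1 hc.2.2.2.2).choose.1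
        (hleaf w hc.1 hc.2.1 hc.2.2.1 hc.2.2.2.1 hc.2.2.2.2).choose.2 s₀
    else stS w with hst'
  set kidsF : Finset (Closeds (blowup Ce)) := Pl₀.image kid with hkidsF
  set wkidsF : Finset (Closeds (blowup Ce)) := Wt.image wkid with hwkidsF
  have hdisj_kw : Disjoint kidsF wkidsF := Finset.disjoint_left.mpr fun ⦃d⦄ hd hd' => by
    obtain ⟨e, he, rfl⟩ := Finset.mem_image.mp hd
    obtain ⟨wt, hwt, hce⟩ := Finset.mem_image.mp hd'
    exact hkid_ne_wkid e he wt hwt hce.symm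
  have hdisj_kws : Disjoint (kidsF.disjUnion wkidsF hdisj_kw) survF := Finset.disjoint_left.mpr fun ⦃d⦄ hd hd' => by
    rcases Finset.mem_disjUnion.mp hd with hd | hd
    · obtain ⟨e, he, rfl⟩ := Finset.mem_image.mp hd
      exact hkid_ne_surv e he _ hd' rfl
    · obtain ⟨wt, hwt, rfl⟩ := Finset.mem_image.mp hd
      exact hwkid_ne_surv wt hwt _ hd' rfl
  set cms' : Finset (Closeds (blowup Ce)) := (kidsF.disjUnion wkidsF hdisj_kw).disjUnion survF hdisj_kws with hcms'
  have hmem_cms' : ∀ d, d ∈ cms' ↔ (∃ e ∈ Pl₀, kid e = d) ∨ (∃ wt ∈ Wt, wkid wt = d) ∨ d ∈ survF := fun d => by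
    rw [hcms', Finset.mem_disjUnion, Finset.mem_disjUnion, hkidsF, hwkidsF, Finset.mem_image, Finset.mem_image, or_assoc]
  set cst' : Closeds (blowup Ce) → State K := fun d =>
    if h : ∃ e ∈ Pl₀, kid e = d then CentreBlowup.step p S₀ h.choose.1 h.choose.2.1 s₀
    else if h' : ∃ wt ∈ Wt, wkid wt = d then CentreBlowup.step p S₀ h'.choose.1 h'.choose.2.1 s₀ else cstS d with hcst'
  set ctr' : Closeds (blowup Ce) → Finset (Fin 4) := fun d =>
    if h : ∃ e ∈ Pl₀, kid e = d then h.choose.2.2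
    else if h' : ∃ wt ∈ Wt, wkid wt = d then h'.choose.2.2 else ctrS d with hctr'
  have hkid_rep : ∀ e ∈ Pl₀, cst' (kid e) = CentreBlowup.step p S₀ e.1 e.2.1 s₀ ∧ ctr' (kid e) = e.2.2 := by
    intro e he
    have h : ∃ e' ∈ Pl₀, kid e' = kid e := ⟨e, he, rfl⟩
    have hch : h.choose = e := hkid_inj _ h.choose_spec.1 e he h.choose_spec.2
    exact ⟨by simp only [hcst', dif_pos h]; rw [hch], by simp only [hctr', dif_pos h]; rw [hch]⟩
  have hwkid_rep : ∀ wt ∈ Wt, cst' (wkid wt) = CentreBlowup.step p S₀ wt.1 wt.2.1 s₀ ∧ ctr' (wkid wt) = wt.2.2 := by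
    intro wt hwt
    have hn : ¬ ∃ e ∈ Pl₀, kid e = wkid wt := fun ⟨e, he, hec⟩ => hkid_ne_wkid e he wt hwt hec
    have h' : ∃ wt' ∈ Wt, wkid wt' = wkid wt := ⟨wt, hwt, rfl⟩
    have hch : h'.choose = wt := hwkid_inj _ h'.choose_spec.1 wt hwt h'.choose_spec.2
    exact ⟨by simp only [hcst', dif_neg hn, dif_pos h']; rw [hch], by simp only [hctr', dif_neg hn, dif_pos h']; rw [hch]⟩
  have hsurv_rep : ∀ d ∈ survF, cst' d = cstS d ∧ ctr' d = ctrS d := by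
    intro d hd
    have hn : ¬ ∃ e ∈ Pl₀, kid e = d := fun ⟨e, he, hec⟩ => hkid_ne_surv e he d hd hec
    have hn' : ¬ ∃ wt ∈ Wt, wkid wt = d := fun ⟨wt, hwt, hec⟩ => hwkid_ne_surv wt hwt d hd hec
    exact ⟨by simp only [hcst', dif_neg hn, dif_neg hn'], by simp only [hctr', dif_neg hn, dif_neg hn']⟩
  haveI : Std.Irrefl (fun q' q : State K × Finset (Fin 4) =>
      (∃ e ∈ plan q.1 q.2, q' = (CentreBlowup.step p q.2 e.1 e.2.1 q.1, e.2.2)) ∧ q' ≠ q) := ⟨fun q hq => hq.2 rfl⟩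
  have hT : Acc (Relation.CutExpand (fun q' q : State K × Finset (Fin 4) =>
      (∃ e ∈ plan q.1 q.2, q' = (CentreBlowup.step p q.2 e.1 e.2.1 q.1, e.2.2)) ∧ q' ≠ q))
      (cms'.val.map fun d => (cst' d, ctr' d)) := by
    refine Relation.acc_of_singleton fun q hq => ?_
    rw [Multiset.mem_map] at hq
    obtain ⟨d, hd, rfl⟩ := hq
    rcases (hmem_cms' d).mp (Finset.mem_val.mp hd) with ⟨e, he, rfl⟩ | ⟨wt, hwt, rfl⟩ | hds
    · obtain ⟨h1, h2⟩ := hkid_rep e he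
      rw [h1, h2]
      exact (Subrelation.accessible (fun hs => hs.1) (hacc e he)).cutExpand
    · obtain ⟨h1, h2⟩ := hwkid_rep wt hwt
      rw [h1, h2]
      exact (Subrelation.accessible (fun hs => hs.1) (hWacc wt hwt)).cutExpand
    · obtain ⟨h1, h2⟩ := hsurv_rep d hds
      rw [h1, h2]
      exact (Subrelation.accessible (fun hs => hs.1) (hsdata d hds).2.2.2.2.2.2.2).cutExpand
  refine exists_isMarkedResolution_of_joint_forest_normalised M₀ hE₀ rfl plan leaves _ hT (blowup Ce)
    (blowup.π Ce ≫ 𝟙 _) M₁ h₁ pts' st' (fun w hw => ?_) (fun w hw => ?_) cms' cst' ctr' rfl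
    (fun d hd => ?_) (fun d hd d' hd' hdd => ?_) (fun w hw d hd => ?_) (fun z hz hzo => ?_)
  · -- closedness of the point members
    rcases (hmem' w).mp hw with hw | hw
    · exact ((hmem_over w).mp hw).1
    · exact (hsurv w hw).1
  · -- data of the point members: leaves and surviving isolated points
    rcases (hmem' w).mp hw with hw | hw
    swap
    · have hst'w : st' w = stS w := by rw [hst']; exact dif_neg fun hc => (hsurvoff w hw).1 hc.2.1
      rw [hst'w]
      exact (hsurv w hw).2
    have hc := (hmem_over w).mp hw
    obtain ⟨hl, hl1, hl2, heq, Y', φ', ψ', _, _, y', hφ', hψ', hMw⟩ :=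
      (hleaf w hc.1 hc.2.1 hc.2.2.1 hc.2.2.2.1 hc.2.2.2.2).choose_spec
    have hst'w : st' w = CentreBlowup.step p S₀ (hleaf w hc.1 hc.2.1 hc.2.2.1 hc.2.2.2.1 hc.2.2.2.2).choose.1
        (hleaf w hc.1 hc.2.1 hc.2.2.1 hc.2.2.2.1 hc.2.2.2.2).choose.2 s₀ := by rw [hst']; exact dif_pos hc
    obtain ⟨haccl, hfinl⟩ := hP3₀ _ hl heq
    rw [hst'w]
    refine ⟨step_F_ne_zero_of_isClean hl1 _ s₀ hF₀ hclean₀ hS₀.2, isClean_step S₀ _ _ s₀,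
      ordAlong_univ_step_of_isEquimultiplePoint' S₀ _ _ s₀ heq, haccl, fun s' hs' => ?_, Y', φ', ψ',
      inferInstance, inferInstance, y', hφ', hψ', hMw⟩
    exact finite_closedOver_model_of_finite_pairs s'
      (ordAlong_univ_of_reflTransGen_edge (ordAlong_univ_step_of_isEquimultiplePoint' S₀ _ _ s₀ heq) hs') (hfinl s' hs')
  · -- data of the coordinate members: children, waiting kids, survivors
    rcases (hmem_cms' d).mp hd with ⟨e, he, rfl⟩ | ⟨wt, hwt, rfl⟩ | hds
    rotate_left 2
    · obtain ⟨hcst, hctr⟩ := hsurv_rep d hds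
      rw [hcst, hctr]
      exact hsdata d hds
    · obtain ⟨hcst, hctr⟩ := hkid_rep e he
      rw [hcst, hctr]
      obtain ⟨hreg, hsnc, hzig, -, -⟩ := hkid e he
      obtain ⟨hj, hbj, hsub, heq, hperm''⟩ := hP1₀ e he
      refine ⟨step_F_ne_zero_of_isClean hj e.2.1 s₀ hF₀ hclean₀ hS₀.2, isClean_step S₀ e.1 e.2.1 s₀, hperm'', hreg,
        hsnc, hzig, fun q hq => hplan q (Or.inl ⟨e, he, hq⟩), hacc e he⟩
    · obtain ⟨hcst, hctr⟩ := hwkid_rep wt hwt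
      rw [hcst, hctr]
      obtain ⟨hreg, hsnc, hzig, -, -⟩ := hwkid wt hwt
      obtain ⟨hj, -, -, -, hperm''⟩ := hW1' wt hwt
      exact ⟨step_F_ne_zero_of_isClean hj wt.2.1 s₀ hF₀ hclean₀ hS₀.2, isClean_step S₀ wt.1 wt.2.1 s₀, hperm'', hreg,
        hsnc, hzig, fun q hq => hplan q (Or.inr ⟨wt, hwt, hq⟩), hWacc wt hwt⟩
  · -- the coordinate members are pairwise disjoint
    have hks : ∀ e ∈ Pl₀, ∀ d ∈ survF, Disjoint (kid e : Set (blowup Ce)) (d : Set (blowup Ce)) := fun e he d hd =>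
      Set.disjoint_left.mpr fun w hw hw' => (hsoff d hd w hw').1 (hkid_over e he w hw)
    have hws : ∀ wt ∈ Wt, ∀ d ∈ survF, Disjoint (wkid wt : Set (blowup Ce)) (d : Set (blowup Ce)) := fun wt hwt d hd =>
      Set.disjoint_left.mpr fun w hw hw' => (hsoff d hd w hw').2 wt hwt (hwkid_coords wt hwt w hw)
    rcases (hmem_cms' d).mp hd with ⟨e, he, rfl⟩ | ⟨wt, hwt, rfl⟩ | hds
    · rcases (hmem_cms' d').mp hd' with ⟨e', he', rfl⟩ | ⟨wt', hwt', rfl⟩ | hds'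
      · exact hkdisj e he e' he' fun h => hdd (by rw [h])
      · exact hkw e he wt' hwt'
      · exact hks e he d' hds'
    · rcases (hmem_cms' d').mp hd' with ⟨e', he', rfl⟩ | ⟨wt', hwt', rfl⟩ | hds'
      · exact (hkw e' he' wt hwt).symm
      · exact hww wt hwt wt' hwt' fun h => hdd (by rw [h])
      · exact hws wt hwt d' hds'
    · rcases (hmem_cms' d').mp hd' with ⟨e', he', rfl⟩ | ⟨wt', hwt', rfl⟩ | hds'
      · exact (hks e' he' d hds).symm
      · exact (hws wt' hwt' d hds).symm
      · exact hsdisj d hds d' hds' hdd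
  · -- point members avoid coordinate members
    rcases (hmem' w).mp hw with hw | hw
    · rcases (hmem_cms' d).mp hd with ⟨e, he, rfl⟩ | ⟨wt, hwt, rfl⟩ | hds
      · exact ((hmem_over w).mp hw).2.2.2.1 e he
      · exact ((hmem_over w).mp hw).2.2.2.2 wt hwt
      · exact fun h => (hsoff d hds w h).1 ((hmem_over w).mp hw).2.1
    · rcases (hmem_cms' d).mp hd with ⟨e, he, rfl⟩ | ⟨wt, hwt, rfl⟩ | hds
      · exact fun h => (hsurvoff w hw).1 (hkid_over e he w h)
      · exact fun h => (hsurvoff w hw).2.1 wt hwt (hwkid_coords wt hwt w h)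
      · exact (hsurvoff w hw).2.2 d hds
  · -- every closed order-`p` point of the new stage is a member
    by_cases hk : ∃ e ∈ Pl₀, z ∈ (kid e : Set (blowup Ce))
    · obtain ⟨e, he, hze⟩ := hk
      exact Or.inr ⟨kid e, (hmem_cms' _).mpr (Or.inl ⟨e, he, rfl⟩), hze⟩
    by_cases hkw' : ∃ wt ∈ Wt, z ∈ (wkid wt : Set (blowup Ce))
    · obtain ⟨wt, hwt, hze⟩ := hkw'
      exact Or.inr ⟨wkid wt, (hmem_cms' _).mpr (Or.inr (Or.inl ⟨wt, hwt, rfl⟩)), hze⟩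
    push Not at hk hkw'
    by_cases hzx : blowup.π Ce z ∈ (c₀ : Set (P 4 K))
    · exact Or.inl ((hmem' z).mpr (Or.inl ((hmem_over z).mpr ⟨hz, hzx, hzo, hk, hkw'⟩)))
    by_cases hW : ∃ wt ∈ Wt, ∀ i ∈ wt.2.2, (X i.succ - C (b₀ i + wt.2.1 i) : A 4 K) ∈ (blowup.π Ce z).asIdeal
    · -- over a waiting member: on its waiting kid (part 36) — contradiction
      exfalso
      obtain ⟨wt, hwt, hagree⟩ := hW
      refine hkw' wt hwt (hwcover z hz hzo (by rw [himg]; exact hzx) wt hwt ?_)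
      obtain ⟨y, hy⟩ := hsurj (blowup.π Ce z)
      refine ⟨y, ?_, hy⟩
      rw [hid, Set.mem_setOf_eq]
      intro i hi
      rw [← hcoord' y i (wt.2.1 i), hy]
      exact hagree i hi
    · rcases hscover z hz hzo hzx (fun wt hwt hall => hW ⟨wt, hwt, hall⟩) with h | ⟨d, hd, hzd⟩
      · exact Or.inl ((hmem' z).mpr (Or.inr h))
      · exact Or.inr ⟨d, (hmem_cms' _).mpr (Or.inr (Or.inr hd)), hzd⟩

end RootWaiting

end Equimultiple

end Summit.ResolutionOfSingularities.ResolutionOfSingularities.Theorems.PIDim4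

end
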